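import Summits.CriticalPhenomena.PercolationContinuityZ3.Theorems.PercNearOneGluingNoHeavyLowerTailForestRayleighTools
import Literature.Combinatorics.SimpleGraph.CycleMatroidRankFunction
import HarnessLib

/-!
# Weighted forest negative correlation — an edge-count criterion for acyclicity (cheap to `decide`)

For a finite edge system `X ⊆ Sym2 V`:

  `⟨X⟩ acyclic ⟺ for every nonempty vertex set S, #{non-loop edges of X inside S} + 1 ≤ |S|`

(`isAcyclic_iff_card_filter_le`). `⇒`: a forest inside `S`, extended by a star from a vertex of `S`
to all vertices outside `S`, is still a forest, and a forest has at most `|V| − 1` edges (cycle-matroid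
rank, `Literature…CycleMatroidRankFunction`); `⇐`: the support `S` of a cycle carries at least `|S|`
edges. Unlike the bridge criterion (`isAcyclic_iff_forall_adj_not_reachable_erase`, which makes the
kernel enumerate walks) this is a pure counting condition, so `decide` evaluates it quickly on
`Fin n`; it drives the computation of the forest families of `W₄`, `K₅ − e`, `K₅`.
Theorems only; no definitions, no `sorry`.
-/

open Finset SimpleGraph
open scoped Classical
open Literature.Combinatorics.SimpleGraph.TuttePolynomial
open Literature.Combinatorics.SimpleGraph.ElementaryGraphSachs

namespace Summit.CriticalPhenomena.PercolationContinuityZ3.Theorems.ForestRayleigh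

variable {V : Type*} [Fintype V] [DecidableEq V]

/-- A loop-free acyclic edge system has at most `|V| − 1` edges. [cycle-matroid rank] -/
theorem card_add_one_le_card_univ_of_isAcyclic {F : Finset (Sym2 V)} (hF : ∀ z ∈ F, ¬z.IsDiag)
    (hne : Nonempty V) (hA : (fromEdgeSet ((F : Finset (Sym2 V)) : Set (Sym2 V))).IsAcyclic) :
    F.card + 1 ≤ Fintype.card V := by
  have hr := (rank_fromEdgeSet_eq_card_iff_isAcyclic hF).2 hA
  have hcc : 1 ≤ Nat.card (fromEdgeSet ((F : Finset (Sym2 V)) : Set (Sym2 V))).ConnectedComponent := by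
    obtain ⟨v⟩ := hne
    haveI : Nonempty (fromEdgeSet ((F : Finset (Sym2 V)) : Set (Sym2 V))).ConnectedComponent :=
      ⟨(fromEdgeSet ((F : Finset (Sym2 V)) : Set (Sym2 V))).connectedComponentMk v⟩
    exact Nat.one_le_iff_ne_zero.2 Nat.card_pos.ne'
  unfold rank at hr
  rw [Nat.card_eq_fintype_card] at hr
  have hV : 1 ≤ Fintype.card V := Fintype.card_pos_iff.2 hne
  omega

/-- Attaching a star from `s₀ ∈ S` to vertices outside `S` keeps a system of edges inside `S`
acyclic and adds one edge per vertex. [pendant edges] -/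
theorem isAcyclic_union_star {F : Finset (Sym2 V)} (hF : ∀ z ∈ F, ¬z.IsDiag) {S : Finset V}
    (hFS : ∀ z ∈ F, ∀ x ∈ z, x ∈ S) {s₀ : V} (hs₀ : s₀ ∈ S)
    (hA : (fromEdgeSet ((F : Finset (Sym2 V)) : Set (Sym2 V))).IsAcyclic) (T : Finset V)
    (hT : ∀ v ∈ T, v ∉ S) :
    (fromEdgeSet ((F ∪ T.image (fun v => s(v, s₀)) : Finset (Sym2 V)) : Set (Sym2 V))).IsAcyclic ∧
    (∀ z ∈ F ∪ T.image (fun v => s(v, s₀)), ¬z.IsDiag) ∧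
    (F ∪ T.image (fun v => s(v, s₀))).card = F.card + T.card := by
  induction T using Finset.induction_on with
  | empty =>
    simp only [Finset.image_empty, Finset.union_empty, Finset.card_empty, add_zero]
    exact ⟨hA, hF, trivial⟩
  | insert v T hv ih =>
    have hT' : ∀ u ∈ T, u ∉ S := fun u hu => hT u (Finset.mem_insert_of_mem hu)
    obtain ⟨hA', hL', hc'⟩ := ih hT'
    have hvS : v ∉ S := hT v (Finset.mem_insert_self _ _)
    have hvs : s₀ ≠ v := fun h => hvS (h ▸ hs₀)
    -- `v` meets no edge of `F ∪ star(T)`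
    have hiso : ∀ z ∈ F ∪ T.image (fun v => s(v, s₀)), v ∉ z := by
      intro z hz hvz
      rcases Finset.mem_union.1 hz with hz | hz
      · exact hvS (hFS z hz v hvz)
      · obtain ⟨u, hu, rfl⟩ := Finset.mem_image.1 hz
        rcases Sym2.mem_iff.1 hvz with h | h
        · exact hv (h ▸ hu)
        · exact hvs h.symm
    have hnew : s(v, s₀) ∉ F ∪ T.image (fun v => s(v, s₀)) :=
      fun h => hiso _ h (Sym2.mem_mk_left _ _)
    have hset : F ∪ (insert v T).image (fun v => s(v, s₀)) =
        insert s(v, s₀) (F ∪ T.image (fun v => s(v, s₀))) := by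
      rw [Finset.image_insert, Finset.union_insert]
    rw [hset, isAcyclic_insert_pendant_iff hL' hiso hvs, Finset.card_insert_of_notMem hnew, hc',
      Finset.card_insert_of_notMem hv]
    refine ⟨hA', ?_, by ring⟩
    intro z hz
    rcases Finset.mem_insert.1 hz with rfl | hz
    · exact fun h => hvs (Sym2.mk_isDiag_iff.1 h).symm
    · exact hL' z hz

/-- **A forest inside a vertex set `S` has at most `|S| − 1` edges.** [cycle-matroid rank] -/
theorem card_add_one_le_of_isAcyclic_inside {F : Finset (Sym2 V)} (hF : ∀ z ∈ F, ¬z.IsDiag)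
    {S : Finset V} (hFS : ∀ z ∈ F, ∀ x ∈ z, x ∈ S) (hS : S.Nonempty)
    (hA : (fromEdgeSet ((F : Finset (Sym2 V)) : Set (Sym2 V))).IsAcyclic) :
    F.card + 1 ≤ S.card := by
  obtain ⟨s₀, hs₀⟩ := hS
  set T := Finset.univ.filter (fun v => v ∉ S) with hT
  have hTS : ∀ v ∈ T, v ∉ S := fun v hv => (Finset.mem_filter.1 hv).2
  obtain ⟨hA', hL', hc'⟩ := isAcyclic_union_star hF hFS hs₀ hA T hTS
  have hbound := card_add_one_le_card_univ_of_isAcyclic hL' ⟨s₀⟩ hA'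
  have hTc : T.card + S.card = Fintype.card V := by
    rw [hT, Finset.filter_not, Finset.card_univ_sdiff, Finset.filter_mem_eq_inter, Finset.univ_inter]
    have := Finset.card_le_univ S
    omega
  omega

/-- The support of a cycle carries at least as many (non-loop) edges as vertices.
[elementary] -/
theorem exists_dense_of_not_isAcyclic {X : Finset (Sym2 V)}
    (h : ¬(fromEdgeSet ((X : Finset (Sym2 V)) : Set (Sym2 V))).IsAcyclic) :
    ∃ S : Finset V, S.Nonempty ∧
      S.card ≤ (X.filter (fun z => ¬z.IsDiag ∧ ∀ x ∈ z, x ∈ S)).card := by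
  unfold SimpleGraph.IsAcyclic at h
  push Not at h
  obtain ⟨v, c, hc⟩ := h
  refine ⟨c.support.toFinset, ⟨v, List.mem_toFinset.2 c.start_mem_support⟩, ?_⟩
  -- the edges of the cycle
  have hsub : c.edges.toFinset ⊆ X.filter (fun z => ¬z.IsDiag ∧ ∀ x ∈ z, x ∈ c.support.toFinset) := by
    intro z hz
    rw [List.mem_toFinset] at hz
    have hzE := c.edges_subset_edgeSet hz
    rw [edgeSet_fromEdgeSet] at hzE
    obtain ⟨hzX, hzd⟩ := hzE
    refine Finset.mem_filter.2 ⟨Finset.mem_coe.1 hzX, hzd, ?_⟩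
    intro x hx
    rw [List.mem_toFinset]
    revert hz hx
    refine Sym2.ind (fun a b => ?_) z
    intro hz hx
    rcases Sym2.mem_iff.1 hx with rfl | rfl
    · exact c.fst_mem_support_of_mem_edges hz
    · exact c.snd_mem_support_of_mem_edges hz
  have hE : c.edges.toFinset.card = c.length := by
    rw [List.toFinset_card_of_nodup hc.edges_nodup, Walk.length_edges]
  have hS : c.support.toFinset.card = c.length := by
    cases c with
    | nil => exact absurd rfl hc.ne_nil
    | cons hadj p =>
      have htail := hc.support_nodup
      rw [Walk.support_cons, List.tail_cons] at htail
      rw [Walk.support_cons, List.toFinset_cons, Finset.insert_eq_of_mem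
        (List.mem_toFinset.2 p.end_mem_support), List.toFinset_card_of_nodup htail,
        Walk.length_support, Walk.length_cons]
  calc c.support.toFinset.card = c.edges.toFinset.card := by rw [hS, hE]
    _ ≤ _ := Finset.card_le_card hsub

/-- **Edge-count criterion for acyclicity.** `⟨X⟩` is acyclic iff every nonempty vertex set `S`
spans at most `|S| − 1` non-loop edges of `X`. [folklore; forests have `|E| ≤ |V| − 1` on every
vertex subset, cycles violate it on their support] -/
theorem isAcyclic_iff_card_filter_le (X : Finset (Sym2 V)) :
    (fromEdgeSet ((X : Finset (Sym2 V)) : Set (Sym2 V))).IsAcyclic ↔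
      ∀ S : Finset V, S.Nonempty →
        (X.filter (fun z => ¬z.IsDiag ∧ ∀ x ∈ z, x ∈ S)).card + 1 ≤ S.card := by
  constructor
  · intro hA S hS
    have hsub : X.filter (fun z => ¬z.IsDiag ∧ ∀ x ∈ z, x ∈ S) ⊆ X := Finset.filter_subset _ _
    exact card_add_one_le_of_isAcyclic_inside (fun z hz => (Finset.mem_filter.1 hz).2.1)
      (fun z hz => (Finset.mem_filter.1 hz).2.2) hS (isAcyclic_of_subset hsub hA)
  · intro h
    by_contra hA
    obtain ⟨S, hS, hle⟩ := exists_dense_of_not_isAcyclic hA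
    have := h S hS
    omega

end Summit.CriticalPhenomena.PercolationContinuityZ3.Theorems.ForestRayleigh
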